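import Summits.ResolutionOfSingularities.ResolutionOfSingularities.Theses.SyzygyFlattening
import Literature.AlgebraicGeometry.Resolution.RegularLocalRingsNormal
import HarnessLib

/-!
# Disproof of `SyzygyFlattening.Globalisation` (crux stmt-ResolutionOfSingularities-17061) — findings

cdisprove seat `refuter-cdisprove-stmt-ResolutionOfSingularities-17061-0`, cycle 1 (2026-08-17).
Everything below is kernel-checked (`lean check` rc 0, 0 sorry, axioms ⊆ {propext, Classical.choice,
Quot.sound}); prose lives in docstrings only. Landed, def-free copies (`--supports` this item):
`Theorems/Globalisation/Negative/SyzygyTowerStageZeroFalse.lean` (p155646, ACCEPTED) and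
`Theorems/Globalisation/Negative/SyzygyTowerNeedsFG.lean` (p156719; the earlier p155067 = same + the
certificate `¬ Globalisation → ¬ ResolutionOfSingularities`, which wedges the gate's route stage and is
therefore kept ONLY here).

## Index of findings

1. SHAPE (`syzygyGlobalisation_iff`, `Iff.rfl`): `Globalisation = ∀ p prime, DZT p → ResolutionInChar p`
   with `DZT p` = termination of the let-bound tower along every DIMENSION-ZERO valuation, for all
   fields `k` of char `p`, all `K`, all f.g. affine models `A ⊆ O` with `Frac A = K` — verbatim the
   conclusion of `HigherRankTermination p`. The let-telescope is mirrored as `def`s `syzLoc`, `syzJ`,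
   `syzChart`, `syzNrm`, `syzTower` (exact mirror, certified by `Iff.rfl`).
2. WHY IT RESISTS (`syzygyGlobalisation_of_summit`, `not_resolutionOfSingularities_of_not_syzygyGlobalisation`,
   `not_syzygyGlobalisation_iff`): the conclusion of the crux at `p` IS the summit's conjunct at `p`, so
   `ResolutionOfSingularities → Globalisation` with the antecedent unused. A refutation of this crux is
   EXACTLY a prime `p` with `DZT p ∧ ¬ ResolutionInChar p` — i.e. it would refute resolution of
   singularities in characteristic `p`. No counterexample search can succeed short of that; the only
   attackable content is the ANTECEDENT `DZT p` (is it junk-true? junk-false?).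
3. LOAD-BEARING ANALYSIS OF THE ANTECEDENT (section `LoadBearing`):
   * `A.FG` is LOAD-BEARING for satisfiability: `dimZeroTermination_false_without_FG` — with `A.FG`
     deleted the antecedent is FALSE at every prime (`k = 𝔽_p`, `K = HahnSeries ℚ 𝔽_p`,
     `O = {orderTop ≥ 0}` non-discrete rank one, residue field `𝔽_p` hence dimension zero, `A = O`):
     the MECHANISM (`syzTower_eq_self`) is that every chart generator `det g / det x` lies in `O` by the
     minimality clause and `loc`, `nrm` stay inside `O`, so on `A = O` the tower is CONSTANT, and `O` is
     not Noetherian (`not_isNoetherianRing_of_hahn`: the ideals `(t^{1/(n+1)})` strictly increase).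
     Consequence `syzygyGlobalisation_without_FG`: the FG-free weakening of the CRUX is VACUOUSLY true.
     Reading for provers: `DZT p` is only ever usable on f.g. (Noetherian) models — as intended.
   * `∀ c, algebraMap k K c ∈ O` is REDUNDANT (`constants_mem_of_le`): it follows from `A ≤ O`.
   * `IsFractionRing ↥A K` dropped: the junk model `A = ⊥` then qualifies, but does NOT falsify the
     antecedent — `syzTower_bot_zero`/`isRegularLocalRing_tower_bot`: `tower ⊥ 0 = ⊥ ≅ k` is a field,
     regular. No cheap kill on this binder (paper: singular `A` with `Frac A ⊊ K` flattens a higher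
     syzygy `Ω^n`, `n = trdeg K > dim A`; e.g. the cusp inside `k(t,u)` still resolves in one step).
   * `DimZero` dropped = the retired rev-0 item 17046 (weaker crux, still implied by the summit).
   * `A ≤ O` dropped: `loc A` then inverts every `s` with `s⁻¹ ∈ O`; e.g. `A = k[1/t]`, `O = k[t]_(t)`
     gives `loc A = K`, a field — again no junk falsity (paper).
4. TIGHTNESS / SLICES known TRUE (no junk falsity of the antecedent): at the trivial valuation `O = ⊤`
   `tower A 0 = loc A = Frac A = K` is a field for EVERY affine model, so the conclusion holds at
   `m = 0` with `DimZero` unused (`syzLoc_top`, `isRegularLocalRing_tower_top`; sharpens the prior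
   seat's `conclusion_top`); `n = 1`: `tower A 1` = normalisation = DVR (paper); regular `A`: fixed
   point (`J = ⊤`, `Ω^n` stably free, `N` principal; paper, = item NoStall's easy half). Dropping
   `p.Prime`: for composite `p > 1` no field has `CharP k p` (both sides vacuous); at `p = 0` the
   statement is `DZT 0 → ResolutionInChar 0`, provable from the vendored `Hironaka1964` (paper).
5. NATURAL STRENGTHENINGS: (a) "stage `m = 0` is already regular" is FALSE at every prime — Lean:
   `syzygyTower_stageZero_false` (cusp `A = 𝔽_p[t²,t³] ⊆ O = 𝔽_p[t]_(t)`: `loc A` contains `t²`, misses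
   `t` — every element is `≡ const (mod t²O)`, `cusp_envelope` — and regular local rings are
   integrally closed, Matsumura 19.4 in the tree); landed copy proposed as
   `Theorems/Globalisation/Negative/SyzygyTowerStageZeroFalse.lean`. So the antecedent is a genuine
   termination statement, bracketed between junk-false (3.) and junk-true (5a). (b) UNIFORM `m`
   (`∃ m ∀ k K O A`) is false on paper — the `A_r` surface points need `⌈r/2⌉` steps (route header
   NUMBERS); not formalised (needs the chart computation). (c) the per-`k` form
   `∀ p k, DZT p k → RIC p k` is a STRONGER crux, equally irrefutable (→ RIC), and is what the birth
   line actually proves through (composites `v∘w` and Chow stay over the same `k`).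
6. TARGETS: none this cycle (no line picked; `stuck_stubs = []`). Remarks on `Lines/birth.lean`:
   both stubs are implied by `ResolutionInChar p` (rattack CRUX-ATTACK-r1.md §Remarks: `stub_oneTower`'s
   `∃ A` is not tied to `M`, so a resolution `X' → M` with `N m := X'` satisfies it) — hence neither stub
   is refutable short of ¬summit either; `stub_oneTower` should be PINNED (`A` a chart of `M` at the
   centre) if the lead wants it to carry the intended content.
7. NEAR-MISSES: none outstanding (nothing here is `sorry`).

## What a prover should take from this file
* Do not try to discharge `Globalisation` by vacuity: its antecedent is neither junk-false (FG models:
  open-problem strength, = crux 17045) nor junk-true (already `tower A 0` of the `A₁`-cone is singular).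
* The antecedent may be applied only to FINITELY GENERATED `A`; every other binder is harmless.
* The honest content is (ii) of the docstring: Zariski-locality of Φ + openness of Reg + RZ compactness
  (birth line). Nothing in this file obstructs it.
-/

noncomputable section

-- single-problem summit: the doubled namespace component is forced by the tree layout
set_option linter.dupNamespace false

namespace Summit.ResolutionOfSingularities.ResolutionOfSingularities.Cruxes.Globalisation.Disproof

open Summit.ResolutionOfSingularities.ResolutionOfSingularities.Theses.SyzygyFlattening (Globalisation)

/-! ## The route's tower, mirrored verbatim as `def`s -/

section Mirror

variable {k K : Type} [Field k] [Field K] [Algebra k K]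

variable (k K) in
/-- `n = trdeg_k K` read as a natural number — mirror of the route's `let n`. [folklore] -/
def syzTrdeg : ℕ := Cardinal.toNat (Algebra.trdeg k K)

/-- `J B` = intersection of the non-regular primes of `B` — mirror of the route's `let J`.
[folklore] -/
def syzJ (B : Subalgebra k K) : Ideal ↥B :=
  sInf ((fun 𝔭 : PrimeSpectrum ↥B => 𝔭.asIdeal) '' {𝔭 : PrimeSpectrum ↥B | ¬ IsRegularLocalRing (Localization.AtPrime 𝔭.asIdeal)})

/-- `loc B` = `B` localised at the centre of `O` — mirror of the route's `let loc`. [folklore] -/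
def syzLoc (O : ValuationSubring K) (B : Subalgebra k K) : Subalgebra k K :=
  Algebra.adjoin k {y : K | ∃ a ∈ B, ∃ s ∈ B, s⁻¹ ∈ O ∧ y = a * s⁻¹}

/-- `chart B` = `B` with the `O`-integral ratios of maximal minors of the `n`-th syzygy of `B / J B`
adjoined — mirror of the route's `let chart` (the index `n` is a parameter here; the tower uses
`n = syzTrdeg k K`). [cite: Villamayor2006Flattening, Thm. 2.7; OnetoZatini1991] -/
def syzChart (O : ValuationSubring K) (n : ℕ) (B : Subalgebra k K) : Subalgebra k K :=
  Algebra.adjoin k ((B : Set K) ∪ {y : K | ∃ (b : ℕ → ℕ) (d : (i : ℕ) → ((Fin (b (i + 1)) → ↥B) →ₗ[↥B] (Fin (b i) → ↥B))) (ε : (Fin (b 0) → ↥B) →ₗ[↥B] (↥B ⧸ syzJ B)) (r : ℕ) (ι : ↥(LinearMap.range (d (n - 1))) →ₗ[↥B] (Fin r → ↥B)), Function.Surjective ε ∧ Function.Exact (d 0) ε ∧ (∀ i : ℕ, Function.Exact (d (i + 1)) (d i)) ∧ Function.Injective ι ∧ (∀ z : Fin r → ↥B, ∃ a : ↥B, a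 ≠ 0 ∧ a • z ∈ LinearMap.range ι) ∧ ∃ g x : Fin r → ↥(LinearMap.range (d (n - 1))), Matrix.det (Matrix.of fun i j => ((ι (x i) j : ↥B) : K)) ≠ 0 ∧ (∀ g' : Fin r → ↥(LinearMap.range (d (n - 1))), Matrix.det (Matrix.of fun i j => ((ι (g' i) j : ↥B) : K)) * (Matrix.det (Matrix.of fun i j => ((ι (x i) j : ↥B) : K)))⁻¹ ∈ O) ∧ y = Matrix.det (Matrix.of fun i j => ((ι (g i) j : ↥B) : K)) * (Matrix.det (Matrix.of fun i j => ((ι (x i) j : ↥B) : K)))⁻¹})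

/-- `nrm B` = integral closure of `B` in `K` — mirror of the route's `let nrm`. [folklore] -/
def syzNrm (B : Subalgebra k K) : Subalgebra k K :=
  Algebra.adjoin k {y : K | IsIntegral ↥B y}

variable (k K) in
/-- The syzygy-flattening tower along `O` from the affine model `A` — mirror of the route's
`let tower` (`T₀ = loc A`, `T_(m+1) = loc (nrm (chart T_m))`). [cite: Villamayor2006Flattening, Thm. 2.7] -/
def syzTower (O : ValuationSubring K) (A : Subalgebra k K) (m : ℕ) : Subalgebra k K :=
  @Nat.rec (fun _ => Subalgebra k K) (syzLoc O A) (fun _ B => syzLoc O (syzNrm (syzChart O (syzTrdeg k K) B))) m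

end Mirror

/-- The crux, unfolded through the mirrored tower: `Globalisation` IS
`∀ p prime, (dimension-zero valuative termination of syzTower) → ResolutionInChar p`, definitionally.
[folklore] -/
theorem syzygyGlobalisation_iff :
    Globalisation ↔ ∀ p : ℕ, p.Prime → (∀ (k K : Type) [Field k] [CharP k p] [Field K] [Algebra k K] (O : ValuationSubring K) (A : Subalgebra k K), (∀ c : k, algebraMap k K c ∈ O) → A.FG → IsFractionRing ↥A K → A.toSubring ≤ O.toSubring → (∀ y : K, y ∈ O → ∃ f : Polynomial k, f ≠ 0 ∧ O.valuation (Polynomial.aeval y f) < 1) → ∃ m : ℕ, IsRegularLocalRing ↥(syzTower k K O A m)) → Literature.AlgebraicGeometry.Resolution.ResolutionInChar.{0} p :=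
  Iff.rfl

/-! ## The crux is implied by the summit (irrefutability certificate) -/

/-- `¬ Globalisation → ¬ ResolutionOfSingularities`: the summit gives `ResolutionInChar p` outright, so it
implies the crux with its antecedent unused; contrapositively every refutation of the crux is a
refutation of resolution of singularities in some prime characteristic. [folklore] -/
theorem not_resolutionOfSingularities_of_not_syzygyGlobalisation :
    ¬ Globalisation → ¬ _root_.ResolutionOfSingularities :=
  fun hG hS => hG fun p hp _ => hS p hp

/-- Sharper: a refutation of the crux is EXACTLY a prime `p` at which the tower terminates along every
dimension-zero valuation while resolution in characteristic `p` fails. [folklore] -/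
theorem not_syzygyGlobalisation_iff :
    ¬ Globalisation ↔ ∃ p : ℕ, p.Prime ∧ (∀ (k K : Type) [Field k] [CharP k p] [Field K] [Algebra k K] (O : ValuationSubring K) (A : Subalgebra k K), (∀ c : k, algebraMap k K c ∈ O) → A.FG → IsFractionRing ↥A K → A.toSubring ≤ O.toSubring → (∀ y : K, y ∈ O → ∃ f : Polynomial k, f ≠ 0 ∧ O.valuation (Polynomial.aeval y f) < 1) → ∃ m : ℕ, IsRegularLocalRing ↥(syzTower k K O A m)) ∧ ¬ Literature.AlgebraicGeometry.Resolution.ResolutionInChar.{0} p := by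
  rw [syzygyGlobalisation_iff]
  push Not
  rfl

/-! ## The mechanism: on `A = O` the tower is constant -/

section FixedPoint

variable {k K : Type} [Field k] [Field K] [Algebra k K] (O : ValuationSubring K) (A : Subalgebra k K)
  (hAO : ∀ x : K, x ∈ A ↔ x ∈ O)
include hAO

/-- `loc` fixes the valuation ring itself. [folklore] -/
theorem syzLoc_eq_self : syzLoc O A = A := by
  refine le_antisymm (Algebra.adjoin_le ?_) fun x hx => Algebra.subset_adjoin ?_
  · rintro y ⟨a, ha, s, -, hsO, rfl⟩
    exact A.mul_mem ha ((hAO _).2 hsO)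
  · exact ⟨x, hx, 1, A.one_mem, by rw [inv_one]; exact O.one_mem, by rw [inv_one, mul_one]⟩

/-- `chart` fixes the valuation ring itself: every adjoined ratio `det g / det x` lies in `O` by the
minimality clause (take `g' := g`). [folklore] -/
theorem syzChart_eq_self (n : ℕ) : syzChart O n A = A := by
  refine le_antisymm (Algebra.adjoin_le ?_) fun x hx => Algebra.subset_adjoin (Set.mem_union_left _ hx)
  rintro y (hy | hy)
  · exact hy
  · obtain ⟨b, d, ε, r, ι, -, -, -, -, -, g, x, -, hx, rfl⟩ := hy
    exact (hAO _).2 (hx g)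

/-- `O.valuation` has `A` as ring of integers when `A` and `O` have the same elements. [folklore] -/
theorem integers_of_forall_mem_iff : O.valuation.Integers ↥A where
  hom_inj := Subtype.val_injective
  map_le_one x := (O.valuation_le_one_iff _).2 ((hAO _).1 x.2)
  exists_of_le_one r hr := ⟨⟨r, (hAO r).2 ((O.valuation_le_one_iff r).1 hr)⟩, rfl⟩

/-- `nrm` fixes the valuation ring itself (valuation rings are integrally closed). [folklore] -/
theorem syzNrm_eq_self : syzNrm A = A := by
  refine le_antisymm (Algebra.adjoin_le ?_) fun x hx => Algebra.subset_adjoin ?_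
  · intro y hy
    have h := (integers_of_forall_mem_iff O A hAO).mem_of_integral hy
    rw [ValuationSubring.integer_valuation] at h
    exact (hAO y).2 h
  · exact (isIntegral_algebraMap (R := ↥A) (A := K) (x := ⟨x, hx⟩))

/-- **Constant tower.** On `A = O` every stage of the syzygy-flattening tower is `A`. [folklore] -/
theorem syzTower_eq_self (m : ℕ) : syzTower k K O A m = A := by
  induction m with
  | zero => exact syzLoc_eq_self O A hAO
  | succ m ih =>
    show syzLoc O (syzNrm (syzChart O (syzTrdeg k K) (syzTower k K O A m))) = A
    rw [ih, syzChart_eq_self O A hAO, syzNrm_eq_self O A hAO, syzLoc_eq_self O A hAO]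

end FixedPoint

/-! ## The witness: Hahn series with rational exponents -/

section Hahn

variable (k : Type) [Field k]

/-- The natural (non-discrete, rank-one) valuation ring `{f | 0 ≤ orderTop f}` of the Hahn-series
field `k((t^ℚ))`. [folklore] -/
theorem exists_valuationSubring_hahnSeries :
    ∃ O : ValuationSubring (HahnSeries ℚ k), ∀ x, x ∈ O ↔ 0 ≤ x.orderTop := by
  refine ⟨⟨{ carrier := {x | 0 ≤ x.orderTop}
             mul_mem' := ?_, one_mem' := ?_, add_mem' := ?_, zero_mem' := ?_, neg_mem' := ?_ }, ?_⟩,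
    fun x => Iff.rfl⟩
  · intro a b ha hb
    refine le_trans ?_ HahnSeries.orderTop_add_le_mul
    exact add_nonneg ha hb
  · show (0 : WithTop ℚ) ≤ (1 : HahnSeries ℚ k).orderTop
    rw [HahnSeries.orderTop_one]
  · intro a b ha hb
    refine le_trans ?_ HahnSeries.min_orderTop_le_orderTop_add
    exact le_min ha hb
  · show (0 : WithTop ℚ) ≤ (0 : HahnSeries ℚ k).orderTop
    rw [HahnSeries.orderTop_zero]
    exact le_top
  · intro x hx
    show (0 : WithTop ℚ) ≤ (-x).orderTop
    rw [HahnSeries.orderTop_neg]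
    exact hx
  · intro x
    by_cases hx : x = 0
    · left
      show (0 : WithTop ℚ) ≤ x.orderTop
      rw [hx, HahnSeries.orderTop_zero]
      exact le_top
    · have hx' : x⁻¹ ≠ 0 := inv_ne_zero hx
      have hsum : x.order + x⁻¹.order = 0 := by
        rw [← HahnSeries.order_mul hx hx', mul_inv_cancel₀ hx, HahnSeries.order_one]
      rcases le_total 0 x.order with h | h
      · left
        show (0 : WithTop ℚ) ≤ x.orderTop
        rw [← HahnSeries.order_eq_orderTop_of_ne_zero hx]
        exact_mod_cast h
      · right
        show (0 : WithTop ℚ) ≤ x⁻¹.orderTop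
        rw [← HahnSeries.order_eq_orderTop_of_ne_zero hx']
        exact_mod_cast (by linarith : (0 : ℚ) ≤ x⁻¹.order)

variable {k}

/-- `algebraMap k k((t^ℚ)) = C` (Mathlib's preferred instance `HahnSeries.powerSeriesAlgebra` factors
through `k⟦X⟧`). [folklore] -/
theorem hahn_algebraMap_apply (c : k) : algebraMap k (HahnSeries ℚ k) c = HahnSeries.C c := by
  rw [HahnSeries.algebraMap_apply', ← PowerSeries.C_eq_algebraMap, HahnSeries.ofPowerSeries_C]

/-- Constants lie in the valuation ring. [folklore] -/
theorem algebraMap_mem_of_hahn (O : ValuationSubring (HahnSeries ℚ k))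
    (hO : ∀ x, x ∈ O ↔ 0 ≤ x.orderTop) (c : k) :
    algebraMap k (HahnSeries ℚ k) c ∈ O := by
  rw [hO, hahn_algebraMap_apply, HahnSeries.C_apply, ← WithTop.coe_zero]
  exact HahnSeries.orderTop_single_le

/-- The valuation ring `{orderTop ≥ 0}` has DIMENSION ZERO over `k`: the residue of `y` is the
constant `y₀ = y.coeff 0 ∈ k`, killed by `X - y₀`. [folklore] -/
theorem hahn_dimZero (O : ValuationSubring (HahnSeries ℚ k)) (hO : ∀ x, x ∈ O ↔ 0 ≤ x.orderTop)
    (y : HahnSeries ℚ k) (hy : y ∈ O) :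
    ∃ f : Polynomial k, f ≠ 0 ∧ O.valuation (Polynomial.aeval y f) < 1 := by
  refine ⟨Polynomial.X - Polynomial.C (y.coeff 0), Polynomial.X_sub_C_ne_zero _, ?_⟩
  have haeval : Polynomial.aeval y (Polynomial.X - Polynomial.C (y.coeff 0)) =
      y - HahnSeries.C (y.coeff 0) := by
    rw [map_sub, Polynomial.aeval_X, Polynomial.aeval_C, hahn_algebraMap_apply]
  rw [haeval]
  have hC : HahnSeries.C (y.coeff 0) ∈ O := by
    have := algebraMap_mem_of_hahn O hO (y.coeff 0)
    rwa [hahn_algebraMap_apply] at this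
  have hzO : y - HahnSeries.C (y.coeff 0) ∈ O := sub_mem hy hC
  rw [← ValuationSubring.mem_nonunits_iff, ValuationSubring.mem_nonunits_iff_or]
  by_cases hz0 : y - HahnSeries.C (y.coeff 0) = 0
  · exact Or.inl hz0
  · right
    intro hzinv
    have h1 : (0 : WithTop ℚ) ≤ (y - HahnSeries.C (y.coeff 0))⁻¹.orderTop := (hO _).1 hzinv
    have h2 : (0 : WithTop ℚ) ≤ (y - HahnSeries.C (y.coeff 0)).orderTop := (hO _).1 hzO
    have hcoeff : (y - HahnSeries.C (y.coeff 0)).coeff 0 = 0 := by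
      rw [HahnSeries.coeff_sub, HahnSeries.C_apply, HahnSeries.coeff_single_same, sub_self]
    have hord0 : (0 : ℚ) ≤ (y - HahnSeries.C (y.coeff 0)).order := by
      rw [← HahnSeries.order_eq_orderTop_of_ne_zero hz0] at h2
      exact_mod_cast h2
    have hzord : (0 : ℚ) < (y - HahnSeries.C (y.coeff 0)).order := by
      rcases lt_or_eq_of_le hord0 with h | h
      · exact h
      · have h' : (y - HahnSeries.C (y.coeff 0)).coeff (y - HahnSeries.C (y.coeff 0)).order = 0 := by
          rw [← h]; exact hcoeff
        exact absurd (HahnSeries.coeff_order_eq_zero.1 h') hz0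
    have hsum : (y - HahnSeries.C (y.coeff 0)).order + (y - HahnSeries.C (y.coeff 0))⁻¹.order = 0 := by
      rw [← HahnSeries.order_mul hz0 (inv_ne_zero hz0), mul_inv_cancel₀ hz0, HahnSeries.order_one]
    have hinv : (0 : ℚ) ≤ (y - HahnSeries.C (y.coeff 0))⁻¹.order := by
      rw [← HahnSeries.order_eq_orderTop_of_ne_zero (inv_ne_zero hz0)] at h1
      exact_mod_cast h1
    linarith

/-- A ring with the same elements as `{orderTop ≥ 0} ⊆ k((t^ℚ))` is NOT Noetherian: the principal
ideals `(t^{1/(n+1)})` strictly increase. [folklore] -/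
theorem not_isNoetherianRing_of_hahn {k₀ : Type} [Field k₀] [Algebra k₀ (HahnSeries ℚ k)]
    (O : ValuationSubring (HahnSeries ℚ k)) (hO : ∀ x, x ∈ O ↔ 0 ≤ x.orderTop)
    (A : Subalgebra k₀ (HahnSeries ℚ k)) (hAO : ∀ x, x ∈ A ↔ x ∈ O) :
    ¬ IsNoetherianRing ↥A := by
  intro hN
  have hmem : ∀ q : ℚ, 0 ≤ q → HahnSeries.single q (1 : k) ∈ A := fun q hq =>
    (hAO _).2 ((hO _).2 (by rw [HahnSeries.orderTop_single one_ne_zero]; exact_mod_cast hq))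
  have hpos : ∀ n : ℕ, (0 : ℚ) < 1 / ((n : ℚ) + 1) := fun n => by positivity
  let t : ℕ → ↥A := fun n => ⟨HahnSeries.single (1 / ((n : ℚ) + 1)) (1 : k), hmem _ (hpos n).le⟩
  have hanti : ∀ n : ℕ, (1 : ℚ) / ((↑(n + 1) : ℚ) + 1) ≤ 1 / ((n : ℚ) + 1) := fun n =>
    one_div_le_one_div_of_le (by positivity) (by push_cast; linarith)
  have hdvd : ∀ n : ℕ, t (n + 1) ∣ t n := fun n => by
    refine Dvd.intro ⟨HahnSeries.single (1 / ((n : ℚ) + 1) - 1 / ((↑(n + 1) : ℚ) + 1)) (1 : k),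
      hmem _ (sub_nonneg.2 (hanti n))⟩ (Subtype.ext ?_)
    show HahnSeries.single _ _ * HahnSeries.single _ _ = HahnSeries.single _ _
    rw [HahnSeries.single_mul_single, mul_one, add_sub_cancel]
  let f : ℕ →o Ideal ↥A :=
    ⟨fun n => Ideal.span {t n}, monotone_nat_of_le_succ fun n =>
      (Ideal.span_singleton_le_span_singleton).2 (hdvd n)⟩
  obtain ⟨N, hN'⟩ := (monotone_stabilizes_iff_noetherian.mpr hN) f
  have hEq : Ideal.span {t N} = Ideal.span {t (N + 1)} := hN' (N + 1) (Nat.le_succ N)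
  have hIn : t (N + 1) ∈ Ideal.span {t N} := hEq ▸ Ideal.subset_span (Set.mem_singleton _)
  obtain ⟨a, ha⟩ := Ideal.mem_span_singleton'.1 hIn
  have haK : ((a : HahnSeries ℚ k) * HahnSeries.single (1 / ((N : ℚ) + 1)) (1 : k)) =
      HahnSeries.single (1 / ((↑(N + 1) : ℚ) + 1)) (1 : k) := congrArg Subtype.val ha
  have ha0 : (0 : WithTop ℚ) ≤ (a : HahnSeries ℚ k).orderTop := (hO _).1 ((hAO _).1 a.2)
  have key : (((1 : ℚ) / ((N : ℚ) + 1) : ℚ) : WithTop ℚ) ≤ (((1 : ℚ) / ((↑(N + 1) : ℚ) + 1) : ℚ) : WithTop ℚ) :=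
    calc (((1 : ℚ) / ((N : ℚ) + 1) : ℚ) : WithTop ℚ)
        = 0 + (HahnSeries.single (1 / ((N : ℚ) + 1)) (1 : k)).orderTop := by
          rw [HahnSeries.orderTop_single one_ne_zero, zero_add]
      _ ≤ (a : HahnSeries ℚ k).orderTop + (HahnSeries.single (1 / ((N : ℚ) + 1)) (1 : k)).orderTop :=
          add_le_add ha0 le_rfl
      _ ≤ ((a : HahnSeries ℚ k) * HahnSeries.single (1 / ((N : ℚ) + 1)) (1 : k)).orderTop :=
          HahnSeries.orderTop_add_le_mul
      _ = (HahnSeries.single (1 / ((↑(N + 1) : ℚ) + 1)) (1 : k)).orderTop := by rw [haK]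
      _ = _ := HahnSeries.orderTop_single one_ne_zero
  have key' : (1 : ℚ) / ((N : ℚ) + 1) ≤ 1 / ((↑(N + 1) : ℚ) + 1) := WithTop.coe_le_coe.mp key
  have hlt : (1 : ℚ) / ((↑(N + 1) : ℚ) + 1) < 1 / ((N : ℚ) + 1) :=
    one_div_lt_one_div_of_lt (by positivity) (by push_cast; linarith)
  linarith

end Hahn

/-- A valuation ring of `K ⊇ k` containing `k` is (the underlying ring of) a `k`-subalgebra.
[folklore] -/
theorem exists_subalgebra_of_valuationSubring {k K : Type} [Field k] [Field K] [Algebra k K]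
    (O : ValuationSubring K) (hk : ∀ c : k, algebraMap k K c ∈ O) :
    ∃ A : Subalgebra k K, ∀ x, x ∈ A ↔ x ∈ O :=
  ⟨{ O.toSubring with algebraMap_mem' := fun c => hk c }, fun _ => Iff.rfl⟩

/-! ## `A.FG` is load-bearing: without it the antecedent is false in every prime characteristic -/

/-- **The `FG`-free antecedent of `SyzygyFlattening.Globalisation` is FALSE** (every prime `p`):
the right-hand side of `syzygyGlobalisation_iff`'s antecedent with the binder `A.FG` deleted and
nothing else changed fails at `k = 𝔽_p`, `K = HahnSeries ℚ 𝔽_p`, `O = {orderTop ≥ 0}`, `A = O`.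
[folklore] -/
theorem dimZeroTermination_false_without_FG (p : ℕ) (hp : p.Prime) :
    ¬ (∀ (k K : Type) [Field k] [CharP k p] [Field K] [Algebra k K] (O : ValuationSubring K) (A : Subalgebra k K), (∀ c : k, algebraMap k K c ∈ O) → IsFractionRing ↥A K → A.toSubring ≤ O.toSubring → (∀ y : K, y ∈ O → ∃ f : Polynomial k, f ≠ 0 ∧ O.valuation (Polynomial.aeval y f) < 1) → ∃ m : ℕ, IsRegularLocalRing ↥(syzTower k K O A m)) := by
  intro H
  haveI : Fact p.Prime := ⟨hp⟩
  obtain ⟨O, hO⟩ := exists_valuationSubring_hahnSeries (ZMod p)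
  have hk : ∀ c : ZMod p, algebraMap (ZMod p) (HahnSeries ℚ (ZMod p)) c ∈ O :=
    algebraMap_mem_of_hahn O hO
  obtain ⟨A, hAO⟩ := exists_subalgebra_of_valuationSubring O hk
  haveI : IsFractionRing ↥A (HahnSeries ℚ (ZMod p)) :=
    (integers_of_forall_mem_iff O A hAO).isFractionRing
  obtain ⟨m, hm⟩ := H (ZMod p) (HahnSeries ℚ (ZMod p)) O A hk inferInstance
    (fun x hx => (hAO x).1 hx) (hahn_dimZero O hO)
  rw [syzTower_eq_self O A hAO m] at hm
  exact not_isNoetherianRing_of_hahn O hO A hAO hm.toIsNoetherian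

/-- **Corollary: the `FG`-free weakening of the crux is VACUOUSLY TRUE.** Deleting `A.FG` from the
antecedent of `Globalisation` yields a statement provable with the antecedent's falsity alone — finite
generation of the affine model is exactly what keeps the crux from being trivial. [folklore] -/
theorem syzygyGlobalisation_without_FG :
    ∀ p : ℕ, p.Prime → (∀ (k K : Type) [Field k] [CharP k p] [Field K] [Algebra k K] (O : ValuationSubring K) (A : Subalgebra k K), (∀ c : k, algebraMap k K c ∈ O) → IsFractionRing ↥A K → A.toSubring ≤ O.toSubring → (∀ y : K, y ∈ O → ∃ f : Polynomial k, f ≠ 0 ∧ O.valuation (Polynomial.aeval y f) < 1) → ∃ m : ℕ, IsRegularLocalRing ↥(syzTower k K O A m)) → Literature.AlgebraicGeometry.Resolution.ResolutionInChar.{0} p :=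
  fun p hp h => absurd h (dimZeroTermination_false_without_FG p hp)


/-! ## Further load-bearing analysis of the antecedent's binders -/

section LoadBearing

variable {k K : Type} [Field k] [Field K] [Algebra k K]

/-- The binder `∀ c, algebraMap k K c ∈ O` of the antecedent is REDUNDANT: it follows from `A ≤ O`.
[folklore] -/
theorem constants_mem_of_le (O : ValuationSubring K) (A : Subalgebra k K)
    (hAO : A.toSubring ≤ O.toSubring) (c : k) : algebraMap k K c ∈ O :=
  hAO (A.algebraMap_mem c)

/-- Dropping `IsFractionRing ↥A K` admits the junk model `A = ⊥`; `loc` fixes it. [folklore] -/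
theorem syzLoc_bot (O : ValuationSubring K) : syzLoc O (⊥ : Subalgebra k K) = ⊥ := by
  refine le_antisymm (Algebra.adjoin_le ?_) bot_le
  rintro y ⟨a, ha, s, hs, -, rfl⟩
  rw [Algebra.mem_bot] at ha hs
  rw [SetLike.mem_coe, Algebra.mem_bot]
  obtain ⟨α, rfl⟩ := ha
  obtain ⟨β, rfl⟩ := hs
  exact ⟨α * β⁻¹, by rw [map_mul, map_inv₀]⟩

/-- … so `tower ⊥ 0 = ⊥`. [folklore] -/
theorem syzTower_bot_zero (O : ValuationSubring K) : syzTower k K O (⊥ : Subalgebra k K) 0 = ⊥ :=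
  syzLoc_bot O

/-- … and `⊥ ≅ k` is a field, hence a regular local ring: the junk model `A = ⊥` does NOT falsify the
`IsFractionRing`-free antecedent (no cheap kill on that binder). [folklore] -/
theorem isRegularLocalRing_tower_bot (O : ValuationSubring K) :
    IsRegularLocalRing ↥(syzTower k K O (⊥ : Subalgebra k K) 0) := by
  rw [syzTower_bot_zero]
  haveI : IsRegularLocalRing k := inferInstance
  exact IsRegularLocalRing.of_ringEquiv (R := k) (Algebra.botEquiv k K).symm.toRingEquiv

/-- The summit implies the crux (antecedent unused). [folklore] -/
theorem syzygyGlobalisation_of_summit : _root_.ResolutionOfSingularities → Globalisation :=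
  fun h p hp _ => h p hp

end LoadBearing


/-! ## Tightness: the trivial valuation `O = ⊤` never kills the antecedent -/

section TopSlice

variable {k K : Type} [Field k] [Field K] [Algebra k K]

/-- At the trivial valuation `O = ⊤`, `loc A = Frac A = K` for every affine model `A` with
`Frac A = K` (every denominator is a unit of `⊤`). [folklore] -/
theorem syzLoc_top (A : Subalgebra k K) [IsFractionRing ↥A K] :
    syzLoc (⊤ : ValuationSubring K) A = ⊤ := by
  refine top_unique fun z _ => Algebra.subset_adjoin ?_
  obtain ⟨a, s, -, rfl⟩ := IsFractionRing.div_surjective (A := ↥A) z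
  exact ⟨a, a.2, s, s.2, ValuationSubring.mem_top _, by rw [div_eq_mul_inv]; rfl⟩

/-- Hence at `O = ⊤` the antecedent's conclusion holds at `m = 0` for EVERY affine model (`K` is a
field, so a regular local ring) — the `DimZero` binder is not even needed: no junk kill of the
antecedent through the trivial valuation. (Sharpens the prior seat's `conclusion_top`.) [folklore] -/
theorem isRegularLocalRing_tower_top (A : Subalgebra k K) [IsFractionRing ↥A K] :
    IsRegularLocalRing ↥(syzTower k K (⊤ : ValuationSubring K) A 0) := by
  show IsRegularLocalRing ↥(syzLoc (⊤ : ValuationSubring K) A)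
  rw [syzLoc_top]
  haveI : IsRegularLocalRing K := inferInstance
  exact IsRegularLocalRing.of_ringEquiv (R := K)
    (Subalgebra.topEquiv (R := k) (A := K)).symm.toRingEquiv

end TopSlice

/-! ## Natural strengthening refuted: stage `m = 0` does not suffice (the cusp) -/

open IsDedekindDomain

section Cusp

variable {k : Type} [Field k]

/-- Constants: `algebraMap k k(t) c = algebraMap k[X] k(t) (C c)`. [folklore] -/
theorem cusp_algebraMap (c : k) :
    algebraMap k (RatFunc k) c = algebraMap (Polynomial k) (RatFunc k) (Polynomial.C c) := by
  rw [IsScalarTower.algebraMap_apply k (Polynomial k) (RatFunc k), Polynomial.algebraMap_eq]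

variable (v : Valuation (RatFunc k) (WithZero (Multiplicative ℤ)))
  (hv : v = (Polynomial.idealX k).valuation (RatFunc k))
include hv

/-- `v(t) = exp(-1)`. [folklore] -/
theorem cusp_v_X : v RatFunc.X = WithZero.exp (-1 : ℤ) := by
  subst hv
  exact Polynomial.valuation_X_eq_neg_one k

/-- Non-zero constants have `v = 1`. [folklore] -/
theorem cusp_v_C {c : k} (hc : c ≠ 0) : v (algebraMap k (RatFunc k) c) = 1 := by
  subst hv
  rw [cusp_algebraMap, HeightOneSpectrum.valuation_eq_one_iff_notMem, Polynomial.idealX_span,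
    Ideal.mem_span_singleton, Polynomial.X_dvd_iff, Polynomial.coeff_C_zero]
  exact hc

/-- Constants have `v ≤ 1`. [folklore] -/
theorem cusp_v_C_le (c : k) : v (algebraMap k (RatFunc k) c) ≤ 1 := by
  by_cases hc : c = 0
  · rw [hc, map_zero, map_zero]; exact zero_le
  · exact (cusp_v_C v hv hc).le

/-- **The envelope.** `S = {z : v z ≤ 1 ∧ ∃ c ∈ k, v (z - c) ≤ exp(-2)}` ("`z ∈ O` and
`z ≡ const (mod t² O)`") is a `k`-subalgebra of `k(t)`. [folklore] -/
theorem cusp_envelope :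
    ∃ S : Subalgebra k (RatFunc k), ∀ z, z ∈ S ↔
      v z ≤ 1 ∧ ∃ c : k, v (z - algebraMap k (RatFunc k) c) ≤ WithZero.exp (-2 : ℤ) := by
  refine ⟨{ carrier := {z | v z ≤ 1 ∧ ∃ c : k, v (z - algebraMap k (RatFunc k) c) ≤ WithZero.exp (-2 : ℤ)}
            mul_mem' := ?_, one_mem' := ?_, add_mem' := ?_, zero_mem' := ?_,
            algebraMap_mem' := ?_ }, fun z => Iff.rfl⟩
  · rintro a b ⟨ha, c, hc⟩ ⟨hb, d, hd⟩
    refine ⟨?_, c * d, ?_⟩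
    · rw [map_mul]; exact mul_le_one' ha hb
    · have : a * b - algebraMap k (RatFunc k) (c * d) =
          a * (b - algebraMap k (RatFunc k) d) + (a - algebraMap k (RatFunc k) c) *
            algebraMap k (RatFunc k) d := by
        rw [map_mul]; ring
      rw [this]
      refine v.map_add_le ?_ ?_
      · rw [map_mul]
        calc v a * v (b - algebraMap k (RatFunc k) d) ≤ 1 * WithZero.exp (-2 : ℤ) :=
              mul_le_mul' ha hd
          _ = _ := one_mul _
      · rw [map_mul]
        calc v (a - algebraMap k (RatFunc k) c) * v (algebraMap k (RatFunc k) d)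
              ≤ WithZero.exp (-2 : ℤ) * 1 := mul_le_mul' hc (cusp_v_C_le v hv d)
          _ = _ := mul_one _
  · refine ⟨by rw [map_one], 1, ?_⟩
    rw [map_one, sub_self, map_zero]; exact zero_le
  · rintro a b ⟨ha, c, hc⟩ ⟨hb, d, hd⟩
    refine ⟨v.map_add_le ha hb, c + d, ?_⟩
    have : a + b - algebraMap k (RatFunc k) (c + d) =
        (a - algebraMap k (RatFunc k) c) + (b - algebraMap k (RatFunc k) d) := by
      rw [map_add]; ring
    rw [this]
    exact v.map_add_le hc hd
  · refine ⟨by rw [map_zero]; exact zero_le, 0, ?_⟩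
    rw [map_zero, sub_zero, map_zero]; exact zero_le
  · intro r
    refine ⟨cusp_v_C_le v hv r, r, ?_⟩
    rw [sub_self, map_zero]; exact zero_le

/-- `t²` and `t³` lie in the envelope. [folklore] -/
theorem cusp_pow_mem_envelope (S : Subalgebra k (RatFunc k))
    (hS : ∀ z, z ∈ S ↔ v z ≤ 1 ∧ ∃ c : k, v (z - algebraMap k (RatFunc k) c) ≤ WithZero.exp (-2 : ℤ))
    (n : ℕ) (hn : 2 ≤ n) : (RatFunc.X : RatFunc k) ^ n ∈ S := by
  have hX := cusp_v_X v hv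
  have hvn : v ((RatFunc.X : RatFunc k) ^ n) = WithZero.exp (-(n : ℤ)) := by
    rw [map_pow, hX, ← WithZero.exp_nsmul]
    congr 1
    simp
  refine (hS _).2 ⟨?_, 0, ?_⟩
  · rw [hvn, ← WithZero.exp_zero, WithZero.exp_le_exp]; omega
  · rw [map_zero, sub_zero, hvn, WithZero.exp_le_exp]; omega

/-- `t` is NOT in the envelope. [folklore] -/
theorem cusp_X_not_mem_envelope (S : Subalgebra k (RatFunc k))
    (hS : ∀ z, z ∈ S ↔ v z ≤ 1 ∧ ∃ c : k, v (z - algebraMap k (RatFunc k) c) ≤ WithZero.exp (-2 : ℤ)) :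
    (RatFunc.X : RatFunc k) ∉ S := by
  rintro hX
  obtain ⟨-, c, hc⟩ := (hS _).1 hX
  have hvX := cusp_v_X v hv
  by_cases hc0 : c = 0
  · rw [hc0, map_zero, sub_zero, hvX, WithZero.exp_le_exp] at hc
    omega
  · have hne : v (RatFunc.X : RatFunc k) ≠ v (-algebraMap k (RatFunc k) c) := by
      rw [Valuation.map_neg, cusp_v_C v hv hc0, hvX, ← WithZero.exp_zero, Ne,
        WithZero.exp_inj]
      omega
    have := Valuation.map_add_of_distinct_val v hne
    rw [← sub_eq_add_neg, Valuation.map_neg, cusp_v_C v hv hc0, hvX] at this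
    rw [this, ← WithZero.exp_zero, max_le_iff, WithZero.exp_le_exp, WithZero.exp_le_exp] at hc
    omega

/-- The envelope contains `loc A` for `A = k[t², t³]` and `O = {v ≤ 1}`: it contains `A`, and it is
closed under inverting `O`-units (`s ≡ d ≠ 0 (mod t²) ⇒ s⁻¹ ≡ d⁻¹ (mod t²)`). [folklore] -/
theorem cusp_loc_le_envelope (O : ValuationSubring (RatFunc k)) (hO : ∀ z, z ∈ O ↔ v z ≤ 1)
    (S : Subalgebra k (RatFunc k))
    (hS : ∀ z, z ∈ S ↔ v z ≤ 1 ∧ ∃ c : k, v (z - algebraMap k (RatFunc k) c) ≤ WithZero.exp (-2 : ℤ)) :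
    Algebra.adjoin k {y : RatFunc k | ∃ a ∈ Algebra.adjoin k {(RatFunc.X : RatFunc k) ^ 2, (RatFunc.X : RatFunc k) ^ 3}, ∃ s ∈ Algebra.adjoin k {(RatFunc.X : RatFunc k) ^ 2, (RatFunc.X : RatFunc k) ^ 3}, s⁻¹ ∈ O ∧ y = a * s⁻¹} ≤ S := by
  have hAS : Algebra.adjoin k {(RatFunc.X : RatFunc k) ^ 2, (RatFunc.X : RatFunc k) ^ 3} ≤ S := by
    refine Algebra.adjoin_le ?_
    rintro z (rfl | rfl)
    · exact cusp_pow_mem_envelope v hv S hS 2 le_rfl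
    · exact cusp_pow_mem_envelope v hv S hS 3 (by norm_num)
  refine Algebra.adjoin_le ?_
  rintro y ⟨a, ha, s, hs, hsO, rfl⟩
  refine S.mul_mem (hAS ha) ?_
  -- `s⁻¹ ∈ S`
  by_cases hs0 : s = 0
  · rw [hs0, inv_zero]; exact S.zero_mem
  obtain ⟨hs1, d, hd⟩ := (hS s).1 (hAS hs)
  have hsinv1 : v s⁻¹ ≤ 1 := (hO _).1 hsO
  have hvs : v s = 1 := by
    refine le_antisymm hs1 ?_
    rw [map_inv₀] at hsinv1
    exact (inv_le_one₀ (zero_lt_iff.2 ((Valuation.ne_zero_iff v).2 hs0))).1 hsinv1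
  have hd0 : d ≠ 0 := by
    rintro rfl
    rw [map_zero, sub_zero, hvs, ← WithZero.exp_zero, WithZero.exp_le_exp] at hd
    omega
  have hvd : v (algebraMap k (RatFunc k) d) = 1 := cusp_v_C v hv hd0
  have hd0' : algebraMap k (RatFunc k) d ≠ 0 := by
    intro h; rw [h, map_zero] at hvd; exact zero_ne_one hvd
  refine (hS _).2 ⟨(hO _).1 hsO, d⁻¹, ?_⟩
  rw [map_inv₀, inv_sub_inv hs0 hd0', map_div₀, map_mul, hvs, hvd, mul_one, div_one,
    Valuation.map_sub_swap]
  exact hd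

omit hv in
/-- Every polynomial multiple of `t²` lies in `A = k[t², t³]`. [folklore] -/
theorem cusp_mul_X_sq_mem (f : Polynomial k) :
    algebraMap (Polynomial k) (RatFunc k) (f * Polynomial.X ^ 2) ∈
      Algebra.adjoin k {(RatFunc.X : RatFunc k) ^ 2, (RatFunc.X : RatFunc k) ^ 3} := by
  have hpow : ∀ n : ℕ, 2 ≤ n → (RatFunc.X : RatFunc k) ^ n ∈
      Algebra.adjoin k {(RatFunc.X : RatFunc k) ^ 2, (RatFunc.X : RatFunc k) ^ 3} := by
    intro n hn
    induction n using Nat.strong_induction_on with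
    | _ n ih =>
      rcases Nat.lt_or_ge n 4 with h | h
      · interval_cases n
        · exact Algebra.subset_adjoin (Set.mem_insert _ _)
        · exact Algebra.subset_adjoin (Set.mem_insert_of_mem _ rfl)
      · have : (RatFunc.X : RatFunc k) ^ n = RatFunc.X ^ 2 * RatFunc.X ^ (n - 2) := by
          rw [← pow_add]; congr 1; omega
        rw [this]
        exact Subalgebra.mul_mem _ (Algebra.subset_adjoin (Set.mem_insert _ _))
          (ih (n - 2) (by omega) (by omega))
  induction f using Polynomial.induction_on' with
  | add p q hp hq => rw [add_mul, map_add]; exact add_mem hp hq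
  | monomial n a =>
    rw [← Polynomial.C_mul_X_pow_eq_monomial, mul_assoc, ← pow_add, map_mul, map_pow,
      RatFunc.algebraMap_X, RatFunc.algebraMap_C, ← RatFunc.algebraMap_eq_C]
    exact Subalgebra.mul_mem _ (Subalgebra.algebraMap_mem _ a) (hpow (n + 2) (by omega))

omit hv in
/-- Any `k`-subalgebra of `k(t)` containing `A = k[t², t³]` has fraction field `k(t)`
(`f/g = (f t²)/(g t²)`). [folklore] -/
theorem cusp_isFractionRing (L : Subalgebra k (RatFunc k))
    (hL : Algebra.adjoin k {(RatFunc.X : RatFunc k) ^ 2, (RatFunc.X : RatFunc k) ^ 3} ≤ L) :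
    IsFractionRing ↥L (RatFunc k) := by
  refine IsFractionRing.of_field (R := ↥L) (K := RatFunc k) (surj := fun z => ?_)
  refine ⟨⟨_, hL (cusp_mul_X_sq_mem z.num)⟩, ⟨_, hL (cusp_mul_X_sq_mem z.denom)⟩, ?_⟩
  show z = algebraMap (Polynomial k) (RatFunc k) (z.num * Polynomial.X ^ 2) /
    algebraMap (Polynomial k) (RatFunc k) (z.denom * Polynomial.X ^ 2)
  have hX2 : algebraMap (Polynomial k) (RatFunc k) (Polynomial.X ^ 2) ≠ 0 := by
    rw [map_pow, RatFunc.algebraMap_X]; exact pow_ne_zero _ RatFunc.X_ne_zero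
  rw [map_mul, map_mul, mul_div_mul_right _ _ hX2, RatFunc.num_div_denom]

/-- The `t`-adic valuation ring has DIMENSION ZERO over `k`: the residue of `y = p/q` (`q(0) ≠ 0`) is
the constant `p(0)/q(0)`. [folklore] -/
theorem cusp_dimZero (O : ValuationSubring (RatFunc k)) (hO : ∀ z, z ∈ O ↔ v z ≤ 1)
    (y : RatFunc k) (hy : y ∈ O) :
    ∃ f : Polynomial k, f ≠ 0 ∧ O.valuation (Polynomial.aeval y f) < 1 := by
  subst hv
  have hq : y.denom ≠ 0 := y.denom_ne_zero
  have hy' : y = algebraMap _ _ y.num / algebraMap _ _ y.denom := (RatFunc.num_div_denom y).symm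
  have hvy : (Polynomial.idealX k).valuation (RatFunc k) y ≤ 1 := (hO y).1 hy
  have hqX : y.denom ∉ (Polynomial.idealX k).asIdeal := by
    rw [hy'] at hvy
    refine (HeightOneSpectrum.valuation_div_le_one_iff (RatFunc k) (Polynomial.idealX k) y.num hq ?_).1 hvy
    intro hqmem hpmem
    rw [Polynomial.idealX_span, Ideal.mem_span_singleton] at hqmem hpmem
    obtain ⟨a, b, hab⟩ := RatFunc.isCoprime_num_denom y
    have h1 : (Polynomial.X : Polynomial k) ∣ 1 :=
      hab ▸ dvd_add (dvd_mul_of_dvd_right hpmem _) (dvd_mul_of_dvd_right hqmem _)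
    exact Polynomial.not_isUnit_X (isUnit_of_dvd_one h1)
  have hq0 : y.denom.coeff 0 ≠ 0 := by
    intro h; apply hqX
    rw [Polynomial.idealX_span, Ideal.mem_span_singleton, Polynomial.X_dvd_iff]; exact h
  set c : k := y.num.coeff 0 / y.denom.coeff 0 with hc
  refine ⟨Polynomial.X - Polynomial.C c, Polynomial.X_sub_C_ne_zero c, ?_⟩
  rw [map_sub, Polynomial.aeval_X, Polynomial.aeval_C]
  rw [← ValuationSubring.mem_nonunits_iff, ValuationSubring.mem_nonunits_iff_or]
  suffices h : (Polynomial.idealX k).valuation (RatFunc k) (y - algebraMap k (RatFunc k) c) < 1 by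
    by_cases h0 : y - algebraMap k (RatFunc k) c = 0
    · exact Or.inl h0
    · right
      intro hmem
      have h1 := (hO _).1 hmem
      rw [map_inv₀] at h1
      have hne : (Polynomial.idealX k).valuation (RatFunc k) (y - algebraMap k (RatFunc k) c) ≠ 0 :=
        (Valuation.ne_zero_iff _).2 h0
      exact absurd ((inv_le_one₀ (zero_lt_iff.2 hne)).1 h1) (not_le.2 h)
  have hq' : algebraMap (Polynomial k) (RatFunc k) y.denom ≠ 0 := by
    simpa using hq
  have hyc : y - algebraMap k (RatFunc k) c =
      algebraMap (Polynomial k) (RatFunc k) (y.num - Polynomial.C c * y.denom) /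
        algebraMap (Polynomial k) (RatFunc k) y.denom := by
    rw [map_sub, map_mul, ← cusp_algebraMap, sub_div, mul_div_assoc, div_self hq', mul_one,
      ← hy']
  rw [hyc, map_div₀, ((Polynomial.idealX k).valuation_eq_one_iff_notMem).2 hqX, div_one]
  refine ((Polynomial.idealX k).valuation_lt_one_iff_mem _).2 ?_
  rw [Polynomial.idealX_span, Ideal.mem_span_singleton, Polynomial.X_dvd_iff, Polynomial.coeff_sub,
    Polynomial.coeff_C_mul, hc, div_mul_cancel₀ _ hq0, sub_self]

omit hv in
/-- `loc A` is not a regular local ring once it misses `t` but contains `t²`: regular local rings are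
integrally closed (Matsumura 19.4, in the tree). [cite: Matsumura1987, Thm. 19.4] -/
theorem cusp_not_isRegularLocalRing (L : Subalgebra k (RatFunc k))
    (hL : Algebra.adjoin k {(RatFunc.X : RatFunc k) ^ 2, (RatFunc.X : RatFunc k) ^ 3} ≤ L)
    (hXL : (RatFunc.X : RatFunc k) ∉ L) : ¬ IsRegularLocalRing ↥L := by
  intro hreg
  haveI : IsFractionRing ↥L (RatFunc k) := cusp_isFractionRing L hL
  haveI : IsIntegrallyClosed ↥L :=
    Literature.AlgebraicGeometry.Resolution.isIntegrallyClosed_of_isRegularLocalRing ↥L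
  have hX2 : (RatFunc.X : RatFunc k) ^ 2 ∈ L := hL (Algebra.subset_adjoin (Set.mem_insert _ _))
  obtain ⟨y, hy⟩ := IsIntegrallyClosed.exists_algebraMap_eq_of_isIntegral_pow (R := ↥L)
    (K := RatFunc k) (x := RatFunc.X) (n := 2) two_pos (isIntegral_algebraMap (x := (⟨_, hX2⟩ : ↥L)))
  exact hXL (hy ▸ y.2)

end Cusp

/-! ## The strengthening "stage `m = 0` is already regular" is false -/

/-- **Stage zero does not suffice** (every prime `p`): the crux's antecedent with its conclusion
`∃ m, IsRegularLocalRing ↥(tower A m)` strengthened to `IsRegularLocalRing ↥(tower A 0)` (and nothing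
else changed: the `let`-telescope is the route file's, byte for byte) is FALSE — witness the cusp
`A = 𝔽_p[t², t³] ⊆ O = 𝔽_p[t]_(t) ⊆ K = 𝔽_p(t)`. [folklore] -/
theorem syzygyTower_stageZero_false (p : ℕ) (hp : p.Prime) :
    ¬ (∀ (k K : Type) [Field k] [CharP k p] [Field K] [Algebra k K] (O : ValuationSubring K) (A : Subalgebra k K), (∀ c : k, algebraMap k K c ∈ O) → A.FG → IsFractionRing ↥A K → A.toSubring ≤ O.toSubring → (∀ y : K, y ∈ O → ∃ f : Polynomial k, f ≠ 0 ∧ O.valuation (Polynomial.aeval y f) < 1) → let n : ℕ := Cardinal.toNat (Algebra.trdeg k K); let J : (B : Subalgebra k K) → Ideal ↥B := fun B => sInf ((fun 𝔭 : PrimeSpectrum ↥B => 𝔭.asIdeal) '' {𝔭 : PrimeSpectrum ↥B | ¬ IsRegularLocalRing (Localization.AtPrime 𝔭.asIdeal)}); let loc : Subalgebra k K → Subalgebra k K := fun B => Algebra.adjoin k {y : K | ∃ a ∈ B, ∃ s ∈ B, s⁻¹ ∈ O ∧ y = a * s⁻¹}; let chart : Subalgebra k K → Subalgebra k K := fun B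 => Algebra.adjoin k ((B : Set K) ∪ {y : K | ∃ (b : ℕ → ℕ) (d : (i : ℕ) → ((Fin (b (i + 1)) → ↥B) →ₗ[↥B] (Fin (b i) → ↥B))) (ε : (Fin (b 0) → ↥B) →ₗ[↥B] (↥B ⧸ J B)) (r : ℕ) (ι : ↥(LinearMap.range (d (n - 1))) →ₗ[↥B] (Fin r → ↥B)), Function.Surjective ε ∧ Function.Exact (d 0) ε ∧ (∀ i : ℕ, Function.Exact (d (i + 1)) (d i)) ∧ Function.Injective ι ∧ (∀ z : Fin r → ↥B, ∃ a : ↥B, a ≠ 0 ∧ a • z ∈ LinearMap.range ι) ∧ ∃ g x : Fin r → ↥(LinearMap.range (d (n - 1))), Matrix.det (Matrix.of fun i j => ((ι (x i) j : ↥B) : K)) ≠ 0 ∧ (∀ g' : Fin r → ↥(LinearMap.range (d (n - 1))), Matrix.det (Matrix.of fun i j => ((ι (g' i) j : ↥B) : K)) * (Matrix.det (Matrix.of fun i j => ((ι (x i) j : ↥B) : K)))⁻¹ ∈ O) ∧ y = Matrix.det (Matrix.of fun i j => ((ι (g i) j : ↥B) : K)) * (Matrix.det (Matrix.of fun i j =>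 ((ι (x i) j : ↥B) : K)))⁻¹}); let nrm : Subalgebra k K → Subalgebra k K := fun B => Algebra.adjoin k {y : K | IsIntegral ↥B y}; let tower : Subalgebra k K → ℕ → Subalgebra k K := fun A m => @Nat.rec (fun _ => Subalgebra k K) (loc A) (fun _ B => loc (nrm (chart B))) m; IsRegularLocalRing ↥(tower A 0)) := by
  intro H
  haveI : Fact p.Prime := ⟨hp⟩
  obtain ⟨S, hS⟩ := cusp_envelope ((Polynomial.idealX (ZMod p)).valuation (RatFunc (ZMod p))) rfl
  have hO : ∀ z, z ∈ ((Polynomial.idealX (ZMod p)).valuation (RatFunc (ZMod p))).valuationSubring ↔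
      (Polynomial.idealX (ZMod p)).valuation (RatFunc (ZMod p)) z ≤ 1 :=
    fun z => Valuation.mem_valuationSubring_iff _ _
  have hk : ∀ c : ZMod p, algebraMap (ZMod p) (RatFunc (ZMod p)) c ∈
      ((Polynomial.idealX (ZMod p)).valuation (RatFunc (ZMod p))).valuationSubring :=
    fun c => (hO _).2 (cusp_v_C_le _ rfl c)
  have hAS : Algebra.adjoin (ZMod p) {(RatFunc.X : RatFunc (ZMod p)) ^ 2, (RatFunc.X : RatFunc (ZMod p)) ^ 3} ≤ S := by
    refine Algebra.adjoin_le ?_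
    rintro z (rfl | rfl)
    · exact cusp_pow_mem_envelope _ rfl S hS 2 le_rfl
    · exact cusp_pow_mem_envelope _ rfl S hS 3 (by norm_num)
  have hFG : (Algebra.adjoin (ZMod p) {(RatFunc.X : RatFunc (ZMod p)) ^ 2, (RatFunc.X : RatFunc (ZMod p)) ^ 3}).FG :=
    Subalgebra.fg_def.2 ⟨_, Set.toFinite _, rfl⟩
  haveI hfrac : IsFractionRing ↥(Algebra.adjoin (ZMod p) {(RatFunc.X : RatFunc (ZMod p)) ^ 2, (RatFunc.X : RatFunc (ZMod p)) ^ 3}) (RatFunc (ZMod p)) :=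
    cusp_isFractionRing _ le_rfl
  have hAO : (Algebra.adjoin (ZMod p) {(RatFunc.X : RatFunc (ZMod p)) ^ 2, (RatFunc.X : RatFunc (ZMod p)) ^ 3}).toSubring ≤
      ((Polynomial.idealX (ZMod p)).valuation (RatFunc (ZMod p))).valuationSubring.toSubring :=
    fun z hz => (hO z).2 ((hS z).1 (hAS hz)).1
  have H' := H (ZMod p) (RatFunc (ZMod p)) _ _ hk hFG hfrac hAO (cusp_dimZero _ rfl _ hO)
  dsimp only at H'
  refine cusp_not_isRegularLocalRing (k := ZMod p) _ ?_ ?_ H'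
  · intro z hz
    exact Algebra.subset_adjoin ⟨z, hz, 1, Subalgebra.one_mem _, by rw [inv_one]; exact one_mem _,
      by rw [inv_one, mul_one]⟩
  · exact fun hX => cusp_X_not_mem_envelope _ rfl S hS (cusp_loc_le_envelope _ rfl _ hO S hS hX)

end Summit.ResolutionOfSingularities.ResolutionOfSingularities.Cruxes.Globalisation.Disproof

end
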